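import Summits.QuantumFields.YangMills.Theorems.UnitScaleTiltProp7GaussCompositeSplit
import Summits.QuantumFields.YangMills.Theorems.UnitScaleTiltProp7FarLayerMassTrace
import HarnessLib

/-!
# Route `UnitScaleTilt`, crux K1 «MinimiserStabilityRegPr» (stmt-QuantumFields-19200), route-R E′ S3 K-form engine, row (P′) ∕ junction row `hVH` — «JCOMM-BOOKING»:
# the junction pairing of the Gauss composite is a COMMUTATOR pairing, booked against ONE commutator family and the far-layer mass
# `2|Σ_y Re tr(φ(y)ᴴ·J_VH(y))| ≤ s·JFAM + s⁻¹·N·(2ℓ⁻¹·M(B) + 2ℓ·G_long(B))`, `JFAM = Σ_{y,μ,r̄ far} |R(A_r̄⁻¹)φ(y) − R(C_r̄⁻¹)φ(y)|²_HS`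

Cell `ym3-torus`, width seat `ym3-torus-px15` (gen 3); `--supports stmt-QuantumFields-19200`, count-neutral (LOCATE «EML-COMM» §1 (J1)–(J3), 19200 evidence #53).
YM₃ on T³ is a ladder rung (R3), not the Clay problem; nothing here claims a mass gap.

WHERE THIS SITS.  The HXB′ door ✓`Prop7GaussCompositeSplit.two_mul_abs_gauss_pairing_le` splits px5's Gauss composite `2|Σ_c Re tr(D_cᴴ·FACE′_c)|` into the
interior Dirichlet part, the mass of `B`, and the JUNCTION `2|Σ_y Re tr(φ(y)ᴴ·J_VH(y))|`, `J_VH(y) = Σ_μ Σ_{r̄ far} (R(A_r̄)B_μ(x̄) − R(C_r̄)B_μ(x̄))` with the two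
transports of the far-layer bond value `B_μ(x̄)` (`x̄ = x^{y−e_μ}_r̄`, `r̄_μ = ℓ − 1`) to the centre frame of `B(y)`: `A_r̄ := T_y(x̄ + e_μ)·V(x̄, μ)⁻¹` (bond, then the
comb of `B(y)`) and `C_r̄ := W̄(y−e_μ, μ)⁻¹·T_{y−e_μ}(x̄)` (the comb of `B(y−e_μ)`, then the coarse unit), `T_y := g_y·axialT V ȳ_y` (✓`block_netFlux_eq_int_add_junction`).
The knit ✓`Prop7RowXbPrimeOfGaussFamRows.hXb_prime_of_gaussFamRows` DISPLAYS this junction as the row `hVH`.  This file books it, with no `‖φ‖` anywhere: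
* §0 `mem_U1_of_mem_unitaryUnits` (a unitary matrix unit is a two-sided contraction — the bridge to FAR-MASS's `U1` letter).
* §1 `re_trace_pair_R_sub_R`: `Re tr(φᴴ·(R(A)X − R(C)X)) = Re tr((R(A⁻¹)φ − R(C⁻¹)φ)ᴴ·X)` — moving the unitaries onto the datum: the junction pairs `B_μ(x̄)` with the
  DIFFERENCE OF THE TWO TRANSPORTS OF THE CENTRE DATUM to `x̄` (`= u*·[m′, u]` with `u = C⁻¹A`, `m′ = R(C⁻¹)φ`: a commutator, LOCATE (J2)); `re_trace_junction_eq` (summed).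
* §2 ★★ `two_mul_abs_junction_pairing_le`: `2|Σ_y Re tr(φ(y)ᴴ·J_VH(y))| ≤ s·JFAM + s⁻¹·M^{HS}_far(B)` for every `s > 0` (Cauchy–Schwarz ✓`two_mul_abs_sum_re_trace_le`).
* §3 ★★★ `two_mul_abs_junction_pairing_le_farMass`: with FAR-MASS ✓`Prop7FarLayerMassTrace.sum_far_layer_mass_le` (`M_far ≤ 2ℓ⁻¹·M + 2ℓ·G_long`) and `HS ≤ N·op²`:
  `2|Σ_y Re tr(φ(y)ᴴ·J_VH(y))| ≤ s·JFAM + s⁻¹·N·(2ℓ⁻¹·Σ_b‖B b‖² + 2ℓ·Σ_b‖R(V b)B(b + e_{μ_b}) − B b‖²)` — the row `hVH` follows from ONE displayed commutator-family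
  row `hJF` on `JFAM` plus (P′)'s plain mass slot and its `G_W(B)` slot (LOCATE (J3); the 4-slot re-letter of the knit is separate).

HONEST SCOPE.  Exact algebra and Cauchy–Schwarz over landed theorems; no curvature, no smallness, no estimate of `JFAM` (that is the displayed row `hJF`, of the
same class as `hKgG` — LOCATE §4 explains why a sup-weight bookkeeping against a plaquette commutator family is short by `ℓ¹` at `d = 3`).  Sorry-free, no `def`,
no `instance`, default heartbeats.

References: T. Bałaban, CMP 95 (1984) 17–40 [Balaban1984PropagatorsI] ((1.18)–(1.21) pp.20–21); CMP 99 (1985) 389–434 [Balaban1985BackgroundPropagators]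
((3.3)–(3.8) pp.390–392); CMP 98 (1985) 17–51 [Balaban1985Averaging] ((9) p.18, p.24); CMP 102 (1985) 277–309 [Balaban1985Variational] (Prop. 7 p.299).
-/

set_option autoImplicit false

noncomputable section

open scoped BigOperators Matrix Matrix.Norms.L2Operator

namespace Summit.QuantumFields.YangMills.Theorems.Prop7JunctionCommBooking

open Literature.MathematicalPhysics.QuantumFieldTheory.Balaban1983to89
open Finset
open B7Prop1Explicit (U1)
open B7Prop2Explicit (unitaryUnits mem_unitaryUnits)
open B7Eq78Linearization (conjR)
open B9Eq39Adjoint (R R_mul R_R_inv R_sub)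
open B10Eq27TorusAxialLog (axialT)
open Summit.QuantumFields.YangMills.Theorems.Prop7CovariantCoercivity (coe_inv_eq_star inv_mem_unitary sum_norm_sq_le_mul_opNorm_sq)
open Summit.QuantumFields.YangMills.Theorems.Prop7CovBlockGaussIntPairing (axialT_mem_unitary re_trace_R_pair)
open Summit.QuantumFields.YangMills.Theorems.Prop7CovBlockGaussIntCS (two_mul_abs_sum_re_trace_le two_mul_abs_sum_sum_sum_le)
open Summit.QuantumFields.YangMills.Theorems.Prop7FarLayerMassTrace (sum_far_layer_mass_le)

variable {P : Params} {k : ℕ} {N : ℕ} [NeZero N]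

/-! ## §0 Unitary units are two-sided contractions -/

/-- A unitary matrix unit lies in `U1` (both `u` and `u⁻¹` have operator norm `≤ 1`) — the bridge between the door's `unitaryUnits` letter and FAR-MASS's `U1` letter.
[cite: Balaban1985Averaging, (9) p.18] -/
theorem mem_U1_of_mem_unitaryUnits {u : (Matrix (Fin N) (Fin N) ℂ)ˣ} (hu : u ∈ unitaryUnits (Matrix (Fin N) (Fin N) ℂ)) :
    u ∈ U1 (Matrix (Fin N) (Fin N) ℂ) := by
  rw [mem_unitaryUnits] at hu
  show ‖(u : Matrix (Fin N) (Fin N) ℂ)‖ ≤ 1 ∧ ‖((u⁻¹ : (Matrix (Fin N) (Fin N) ℂ)ˣ) : Matrix (Fin N) (Fin N) ℂ)‖ ≤ 1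
  exact ⟨(CStarRing.norm_of_mem_unitary hu).le, (CStarRing.norm_of_mem_unitary (inv_mem_unitary hu)).le⟩

/-! ## §1 The junction pairs `B` with the difference of the two transports of the datum -/

omit [NeZero N] in
/-- **MOVING THE UNITARIES ONTO THE DATUM**: `Re tr(φᴴ·(R(A)X − R(C)X)) = Re tr((R(A⁻¹)φ − R(C⁻¹)φ)ᴴ·X)` for unitary units `A`, `C` — the junction summand pairs the bond value
with the difference of the two transports of the centre datum (`R(A⁻¹)φ − R(C⁻¹)φ = R(C⁻¹)(R(u⁻¹)φ′ − φ′)`-class, `u = C⁻¹A`: a commutator; no `‖φ‖`).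
[cite: Balaban1984PropagatorsI, (1.21) p.21; Balaban1985BackgroundPropagators, (3.5) p.391] -/
theorem re_trace_pair_R_sub_R {A C : (Matrix (Fin N) (Fin N) ℂ)ˣ} (hA : (A : Matrix (Fin N) (Fin N) ℂ) ∈ unitary (Matrix (Fin N) (Fin N) ℂ))
    (hC : (C : Matrix (Fin N) (Fin N) ℂ) ∈ unitary (Matrix (Fin N) (Fin N) ℂ)) (φ X : Matrix (Fin N) (Fin N) ℂ) :
    ((φᴴ * (R A X - R C X)).trace).re = (((R A⁻¹ φ - R C⁻¹ φ)ᴴ * X).trace).re := by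
  have h1 : ((φᴴ * R A X).trace).re = (((R A⁻¹ φ)ᴴ * X).trace).re := by
    have := re_trace_R_pair hA (R A⁻¹ φ) X
    rwa [R_R_inv] at this
  have h2 : ((φᴴ * R C X).trace).re = (((R C⁻¹ φ)ᴴ * X).trace).re := by
    have := re_trace_R_pair hC (R C⁻¹ φ) X
    rwa [R_R_inv] at this
  rw [Matrix.mul_sub, Matrix.trace_sub, Complex.sub_re, h1, h2, Matrix.conjTranspose_sub, Matrix.sub_mul, Matrix.trace_sub, Complex.sub_re]

section Junction

variable (hk : k ≤ P.m + P.K)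
  {V : GaugeField P 0 (Matrix (Fin N) (Fin N) ℂ)ˣ} (hV : ∀ b, V b ∈ unitaryUnits (Matrix (Fin N) (Fin N) ℂ))
  {Wc : PBond P k → (Matrix (Fin N) (Fin N) ℂ)ˣ} (hWc : ∀ c, (Wc c : Matrix (Fin N) (Fin N) ℂ) ∈ unitary (Matrix (Fin N) (Fin N) ℂ))
  {g : Site P k → (Matrix (Fin N) (Fin N) ℂ)ˣ} (hg : ∀ y, (g y : Matrix (Fin N) (Fin N) ℂ) ∈ unitary (Matrix (Fin N) (Fin N) ℂ))

include hV hg in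
omit [NeZero N] in
/-- The centre-frame comb transport `T_y(x) = g_y·axialT V ȳ_y x` is unitary. [cite: Balaban1985Averaging, p.24] -/
theorem coe_frame_axialT_mem_unitary (y : Site P k) (x : Site P 0) :
    ((g y * axialT V (Site.fibreSite 0 k y fun _ => ⟨0, pow_pos P.L_pos k⟩) x : (Matrix (Fin N) (Fin N) ℂ)ˣ) : Matrix (Fin N) (Fin N) ℂ)
      ∈ unitary (Matrix (Fin N) (Fin N) ℂ) := by
  rw [Units.val_mul]
  exact Submonoid.mul_mem _ (hg y) (axialT_mem_unitary hV _ x)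

include hV hWc hg in
omit [NeZero N] in
/-- ★ **THE JUNCTION PAIRING, BLOCK BY BLOCK, IN COMMUTATOR FORM**: `Re tr(φ(y)ᴴ·J_VH(y)) = Σ_μ Σ_{r̄ far} Re tr((R(A_r̄⁻¹)φ(y) − R(C_r̄⁻¹)φ(y))ᴴ · B_μ(x̄_r̄))` with the door's
transports `A_r̄ = T_y(x̄+e_μ)·V(x̄,μ)⁻¹`, `C_r̄ = W̄(y−e_μ,μ)⁻¹·T_{y−e_μ}(x̄)` (✓ `block_netFlux_eq_int_add_junction`'s junction, ✓ `two_mul_abs_gauss_pairing_le`'s third term).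
[cite: Balaban1984PropagatorsI, (1.21) p.21; Balaban1985BackgroundPropagators, (3.3)-(3.8) pp.390-392] -/
theorem re_trace_junction_eq (φ : Site P k → Matrix (Fin N) (Fin N) ℂ) (B : Fin P.d → Site P 0 → Matrix (Fin N) (Fin N) ℂ) (y : Site P k) :
    (((φ y)ᴴ * ∑ μ : Fin P.d, ∑ r ∈ univ.filter (fun r : Fin P.d → Fin (P.L ^ k) => (r μ : ℕ) + 1 = P.L ^ k),
        (R (g y * axialT V (Site.fibreSite 0 k y fun _ => ⟨0, pow_pos P.L_pos k⟩) (Site.fibreSite 0 k y (Function.update r μ ⟨0, pow_pos P.L_pos k⟩))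
              * (V ⟨Site.fibreSite 0 k (y.unshift μ) r, μ⟩)⁻¹) (B μ (Site.fibreSite 0 k (y.unshift μ) r))
          - R ((Wc ⟨y.unshift μ, μ⟩)⁻¹ * (g (y.unshift μ) * axialT V (Site.fibreSite 0 k (y.unshift μ) fun _ => ⟨0, pow_pos P.L_pos k⟩) (Site.fibreSite 0 k (y.unshift μ) r)))
              (B μ (Site.fibreSite 0 k (y.unshift μ) r)))).trace).re
      = ∑ μ : Fin P.d, ∑ r ∈ univ.filter (fun r : Fin P.d → Fin (P.L ^ k) => (r μ : ℕ) + 1 = P.L ^ k),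
          ((((R (g y * axialT V (Site.fibreSite 0 k y fun _ => ⟨0, pow_pos P.L_pos k⟩) (Site.fibreSite 0 k y (Function.update r μ ⟨0, pow_pos P.L_pos k⟩))
                  * (V ⟨Site.fibreSite 0 k (y.unshift μ) r, μ⟩)⁻¹)⁻¹ (φ y)
              - R ((Wc ⟨y.unshift μ, μ⟩)⁻¹ * (g (y.unshift μ) * axialT V (Site.fibreSite 0 k (y.unshift μ) fun _ => ⟨0, pow_pos P.L_pos k⟩) (Site.fibreSite 0 k (y.unshift μ) r)))⁻¹
                  (φ y)))ᴴ
            * B μ (Site.fibreSite 0 k (y.unshift μ) r)).trace).re := by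
  rw [Finset.mul_sum, Matrix.trace_sum, Complex.re_sum]
  refine Finset.sum_congr rfl fun μ _ => ?_
  rw [Finset.mul_sum, Matrix.trace_sum, Complex.re_sum]
  refine Finset.sum_congr rfl fun r _ => ?_
  have hA : ((g y * axialT V (Site.fibreSite 0 k y fun _ => ⟨0, pow_pos P.L_pos k⟩) (Site.fibreSite 0 k y (Function.update r μ ⟨0, pow_pos P.L_pos k⟩))
        * (V ⟨Site.fibreSite 0 k (y.unshift μ) r, μ⟩)⁻¹ : (Matrix (Fin N) (Fin N) ℂ)ˣ) : Matrix (Fin N) (Fin N) ℂ) ∈ unitary (Matrix (Fin N) (Fin N) ℂ) := by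
    rw [Units.val_mul]
    exact Submonoid.mul_mem _ (coe_frame_axialT_mem_unitary hV hg y _) (inv_mem_unitary (hV _))
  have hC : (((Wc ⟨y.unshift μ, μ⟩)⁻¹ * (g (y.unshift μ) * axialT V (Site.fibreSite 0 k (y.unshift μ) fun _ => ⟨0, pow_pos P.L_pos k⟩)
        (Site.fibreSite 0 k (y.unshift μ) r)) : (Matrix (Fin N) (Fin N) ℂ)ˣ) : Matrix (Fin N) (Fin N) ℂ) ∈ unitary (Matrix (Fin N) (Fin N) ℂ) := by
    rw [Units.val_mul]
    exact Submonoid.mul_mem _ (inv_mem_unitary (hWc _)) (coe_frame_axialT_mem_unitary hV hg _ _)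
  exact re_trace_pair_R_sub_R hA hC (φ y) _

/-! ## §2 Cauchy–Schwarz: the junction against the commutator family and the far-layer HS mass -/

include hV hWc hg in
omit [NeZero N] in
/-- ★★ **JCOMM, CAUCHY–SCHWARZ FORM**: for every `s > 0`,
`2|Σ_y Re tr(φ(y)ᴴ·J_VH(y))| ≤ s·Σ_{y,μ,r̄ far} |R(A_r̄⁻¹)φ(y) − R(C_r̄⁻¹)φ(y)|²_HS + s⁻¹·Σ_{y,μ,r̄ far} |B_μ(x̄_r̄)|²_HS` — the junction row is paid by ONE commutator family
(`JFAM`, displayed) and the HS mass of `B` on the blocks' far layers only. [cite: Balaban1984PropagatorsI, (1.18)-(1.21) pp.20-21; Balaban1985BackgroundPropagators, (3.5) p.391] -/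
theorem two_mul_abs_junction_pairing_le (φ : Site P k → Matrix (Fin N) (Fin N) ℂ) (B : Fin P.d → Site P 0 → Matrix (Fin N) (Fin N) ℂ) {s : ℝ} (hs : 0 < s) :
    2 * |∑ y : Site P k, (((φ y)ᴴ * ∑ μ : Fin P.d, ∑ r ∈ univ.filter (fun r : Fin P.d → Fin (P.L ^ k) => (r μ : ℕ) + 1 = P.L ^ k),
        (R (g y * axialT V (Site.fibreSite 0 k y fun _ => ⟨0, pow_pos P.L_pos k⟩) (Site.fibreSite 0 k y (Function.update r μ ⟨0, pow_pos P.L_pos k⟩))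
              * (V ⟨Site.fibreSite 0 k (y.unshift μ) r, μ⟩)⁻¹) (B μ (Site.fibreSite 0 k (y.unshift μ) r))
          - R ((Wc ⟨y.unshift μ, μ⟩)⁻¹ * (g (y.unshift μ) * axialT V (Site.fibreSite 0 k (y.unshift μ) fun _ => ⟨0, pow_pos P.L_pos k⟩) (Site.fibreSite 0 k (y.unshift μ) r)))
              (B μ (Site.fibreSite 0 k (y.unshift μ) r)))).trace).re|
      ≤ s * ∑ y : Site P k, ∑ μ : Fin P.d, ∑ r ∈ univ.filter (fun r : Fin P.d → Fin (P.L ^ k) => (r μ : ℕ) + 1 = P.L ^ k), ∑ j : Fin N, ∑ l : Fin N,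
            ‖(R (g y * axialT V (Site.fibreSite 0 k y fun _ => ⟨0, pow_pos P.L_pos k⟩) (Site.fibreSite 0 k y (Function.update r μ ⟨0, pow_pos P.L_pos k⟩))
                    * (V ⟨Site.fibreSite 0 k (y.unshift μ) r, μ⟩)⁻¹)⁻¹ (φ y)
                - R ((Wc ⟨y.unshift μ, μ⟩)⁻¹ * (g (y.unshift μ) * axialT V (Site.fibreSite 0 k (y.unshift μ) fun _ => ⟨0, pow_pos P.L_pos k⟩) (Site.fibreSite 0 k (y.unshift μ) r)))⁻¹
                    (φ y)) j l‖ ^ 2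
        + s⁻¹ * ∑ y : Site P k, ∑ μ : Fin P.d, ∑ r ∈ univ.filter (fun r : Fin P.d → Fin (P.L ^ k) => (r μ : ℕ) + 1 = P.L ^ k), ∑ j : Fin N, ∑ l : Fin N,
            ‖B μ (Site.fibreSite 0 k (y.unshift μ) r) j l‖ ^ 2 := by
  rw [Finset.sum_congr rfl fun y _ => re_trace_junction_eq hV hWc hg φ B y]
  exact two_mul_abs_sum_sum_sum_le univ univ (fun μ => univ.filter (fun r : Fin P.d → Fin (P.L ^ k) => (r μ : ℕ) + 1 = P.L ^ k))
    (fun y μ r => ((((R (g y * axialT V (Site.fibreSite 0 k y fun _ => ⟨0, pow_pos P.L_pos k⟩) (Site.fibreSite 0 k y (Function.update r μ ⟨0, pow_pos P.L_pos k⟩))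
                  * (V ⟨Site.fibreSite 0 k (y.unshift μ) r, μ⟩)⁻¹)⁻¹ (φ y)
              - R ((Wc ⟨y.unshift μ, μ⟩)⁻¹ * (g (y.unshift μ) * axialT V (Site.fibreSite 0 k (y.unshift μ) fun _ => ⟨0, pow_pos P.L_pos k⟩) (Site.fibreSite 0 k (y.unshift μ) r)))⁻¹
                  (φ y)))ᴴ * B μ (Site.fibreSite 0 k (y.unshift μ) r)).trace).re)
    (fun y μ r => ∑ j : Fin N, ∑ l : Fin N,
            ‖(R (g y * axialT V (Site.fibreSite 0 k y fun _ => ⟨0, pow_pos P.L_pos k⟩) (Site.fibreSite 0 k y (Function.update r μ ⟨0, pow_pos P.L_pos k⟩))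
                    * (V ⟨Site.fibreSite 0 k (y.unshift μ) r, μ⟩)⁻¹)⁻¹ (φ y)
                - R ((Wc ⟨y.unshift μ, μ⟩)⁻¹ * (g (y.unshift μ) * axialT V (Site.fibreSite 0 k (y.unshift μ) fun _ => ⟨0, pow_pos P.L_pos k⟩) (Site.fibreSite 0 k (y.unshift μ) r)))⁻¹
                    (φ y)) j l‖ ^ 2)
    (fun y μ r => ∑ j : Fin N, ∑ l : Fin N, ‖B μ (Site.fibreSite 0 k (y.unshift μ) r) j l‖ ^ 2)
    (fun y _ μ _ => two_mul_abs_sum_re_trace_le _ hs _ _)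

/-! ## §3 With FAR-MASS: the junction against the commutator family, the mass and the longitudinal gradient energy -/

include hV hWc hg in
/-- ★★★ **JCOMM-BOOKING**: with `h : sitesPerDir 0 = L^k·sitesPerDir k` (`ℓ = L^k`), for every `s > 0`,
`2|Σ_y Re tr(φ(y)ᴴ·J_VH(y))| ≤ s·JFAM + s⁻¹·N·(2ℓ⁻¹·Σ_b‖B b‖² + 2ℓ·Σ_b‖R(V b)B(b + e_{μ_b}) − B b‖²)` — the junction row `hVH` of (P′) follows from ONE displayed row on the
commutator family `JFAM = Σ_{y,μ,r̄ far}|R(A_r̄⁻¹)φ(y) − R(C_r̄⁻¹)φ(y)|²_HS` plus (P′)'s plain mass slot and its longitudinal-gradient slot (FAR-MASS ✓ `sum_far_layer_mass_le`).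
[cite: Balaban1984PropagatorsI, (1.18)-(1.21) pp.20-21; Balaban1985RegularSpaces, (1.1) p.76; Balaban1985Variational, Prop. 7 p.299] -/
theorem two_mul_abs_junction_pairing_le_farMass (h : P.sitesPerDir 0 = P.L ^ k * P.sitesPerDir k)
    (φ : Site P k → Matrix (Fin N) (Fin N) ℂ) (B : Fin P.d → Site P 0 → Matrix (Fin N) (Fin N) ℂ) {s : ℝ} (hs : 0 < s) :
    2 * |∑ y : Site P k, (((φ y)ᴴ * ∑ μ : Fin P.d, ∑ r ∈ univ.filter (fun r : Fin P.d → Fin (P.L ^ k) => (r μ : ℕ) + 1 = P.L ^ k),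
        (R (g y * axialT V (Site.fibreSite 0 k y fun _ => ⟨0, pow_pos P.L_pos k⟩) (Site.fibreSite 0 k y (Function.update r μ ⟨0, pow_pos P.L_pos k⟩))
              * (V ⟨Site.fibreSite 0 k (y.unshift μ) r, μ⟩)⁻¹) (B μ (Site.fibreSite 0 k (y.unshift μ) r))
          - R ((Wc ⟨y.unshift μ, μ⟩)⁻¹ * (g (y.unshift μ) * axialT V (Site.fibreSite 0 k (y.unshift μ) fun _ => ⟨0, pow_pos P.L_pos k⟩) (Site.fibreSite 0 k (y.unshift μ) r)))
              (B μ (Site.fibreSite 0 k (y.unshift μ) r)))).trace).re|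
      ≤ s * ∑ y : Site P k, ∑ μ : Fin P.d, ∑ r ∈ univ.filter (fun r : Fin P.d → Fin (P.L ^ k) => (r μ : ℕ) + 1 = P.L ^ k), ∑ j : Fin N, ∑ l : Fin N,
            ‖(R (g y * axialT V (Site.fibreSite 0 k y fun _ => ⟨0, pow_pos P.L_pos k⟩) (Site.fibreSite 0 k y (Function.update r μ ⟨0, pow_pos P.L_pos k⟩))
                    * (V ⟨Site.fibreSite 0 k (y.unshift μ) r, μ⟩)⁻¹)⁻¹ (φ y)
                - R ((Wc ⟨y.unshift μ, μ⟩)⁻¹ * (g (y.unshift μ) * axialT V (Site.fibreSite 0 k (y.unshift μ) fun _ => ⟨0, pow_pos P.L_pos k⟩) (Site.fibreSite 0 k (y.unshift μ) r)))⁻¹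
                    (φ y)) j l‖ ^ 2
        + s⁻¹ * (N * (2 * ((P.L : ℝ) ^ k)⁻¹ * ∑ b : PBond P 0, ‖B b.dir b.src‖ ^ 2
            + 2 * ((P.L : ℝ) ^ k) * ∑ b : PBond P 0, ‖conjR (V b) (B b.dir (b.src.shift b.dir)) - B b.dir b.src‖ ^ 2)) := by
  have h1 := two_mul_abs_junction_pairing_le hV hWc hg φ B hs
  -- HS ≤ N·op² on the far layers
  have hHS : ∑ y : Site P k, ∑ μ : Fin P.d, ∑ r ∈ univ.filter (fun r : Fin P.d → Fin (P.L ^ k) => (r μ : ℕ) + 1 = P.L ^ k), ∑ j : Fin N, ∑ l : Fin N,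
        ‖B μ (Site.fibreSite 0 k (y.unshift μ) r) j l‖ ^ 2
      ≤ N * ∑ y : Site P k, ∑ μ : Fin P.d, ∑ r ∈ univ.filter (fun r : Fin P.d → Fin (P.L ^ k) => (r μ : ℕ) + 1 = P.L ^ k),
          ‖B μ (Site.fibreSite 0 k (y.unshift μ) r)‖ ^ 2 := by
    rw [Finset.mul_sum]
    refine Finset.sum_le_sum fun y _ => ?_
    rw [Finset.mul_sum]
    refine Finset.sum_le_sum fun μ _ => ?_
    rw [Finset.mul_sum]
    exact Finset.sum_le_sum fun r _ => sum_norm_sq_le_mul_opNorm_sq _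
  -- the far layer of `B(y − e_μ)` re-indexed over `y`: `y ↦ y − e_μ` is a bijection of the coarse torus
  have hreidx : ∑ y : Site P k, ∑ μ : Fin P.d, ∑ r ∈ univ.filter (fun r : Fin P.d → Fin (P.L ^ k) => (r μ : ℕ) + 1 = P.L ^ k),
        ‖B μ (Site.fibreSite 0 k (y.unshift μ) r)‖ ^ 2
      = ∑ y : Site P k, ∑ μ : Fin P.d, ∑ r ∈ univ.filter (fun r : Fin P.d → Fin (P.L ^ k) => (r μ : ℕ) + 1 = P.L ^ k),
        ‖B μ (Site.fibreSite 0 k y r)‖ ^ 2 := by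
    rw [Finset.sum_comm]
    conv_rhs => rw [Finset.sum_comm]
    refine Finset.sum_congr rfl fun μ _ => ?_
    exact Fintype.sum_equiv (B10StarCount.shiftEquiv μ).symm _ _ fun y => rfl
  -- FAR-MASS for the bond function `b ↦ B b.dir b.src`
  have hF := sum_far_layer_mass_le h (V := V) (fun b => mem_U1_of_mem_unitaryUnits (hV b)) (fun b => B b.dir b.src)
  dsimp only at hF
  have hN : (0 : ℝ) ≤ N := Nat.cast_nonneg _
  have h2 : ∑ y : Site P k, ∑ μ : Fin P.d, ∑ r ∈ univ.filter (fun r : Fin P.d → Fin (P.L ^ k) => (r μ : ℕ) + 1 = P.L ^ k), ∑ j : Fin N, ∑ l : Fin N,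
        ‖B μ (Site.fibreSite 0 k (y.unshift μ) r) j l‖ ^ 2
      ≤ N * (2 * ((P.L : ℝ) ^ k)⁻¹ * ∑ b : PBond P 0, ‖B b.dir b.src‖ ^ 2
            + 2 * ((P.L : ℝ) ^ k) * ∑ b : PBond P 0, ‖conjR (V b) (B b.dir (b.src.shift b.dir)) - B b.dir b.src‖ ^ 2) := by
    rw [hreidx] at hHS
    exact hHS.trans (mul_le_mul_of_nonneg_left hF hN)
  have h3 := mul_le_mul_of_nonneg_left h2 (inv_nonneg.mpr hs.le)
  linarith

end Junction

end Summit.QuantumFields.YangMills.Theorems.Prop7JunctionCommBooking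

end
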